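import Summits.PneNP.PneNP.Theorems.SoloBlindStreamingMCSPSpace
import Summits.PneNP.PneNP.Theorems.SoloBlindStreamingTimeOnly
import HarnessLib

/-!
# THEOREM H♭ — level one of the McKay–Murray–Williams family in update TIME, for every space bound

`StreamingLowerBound s` (tree, `UniformStreaming`) asks `MCSP[s] ∉ USTREAM (s(⌊log₂N⌋)^c + c)
(s(⌊log₂N⌋)^c + c)` for every `c`. THEOREM H (`SoloBlindStreamingMCSPSpace`) proved level `c = 1`
in SPACE for every algorithm. Here the uniform TIME parameter alone already decides level one,
whatever the space bound: uniform update/report time `T` forces every reached state to have length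
`≤ D · T N` for a machine-dependent constant `D` (the halting rule of the tree's `TM2OutputsInTime`,
`exists_runsInSpace_mul_of_uniformTime` of `SoloBlindStreamingTimeOnly`), and THEOREM H excludes
space `o(s log s)`.

**THEOREM H♭ (`MCSPSize_not_mem_USTREAM_time_level_one`).** If `s n ≥ n` for all `n` and
`s n ≤ 2^(n-10)/n` for infinitely many `n`, then for EVERY `S : ℕ → ℕ`,
`MCSP[s] ∉ USTREAM S (fun N => s(⌊log₂N⌋) + 1)`.

So in the `(space, time)`-plane of the family the PROVED region is `{space < s log s / 2^17}`
(THEOREM H, all algorithms) `∪ {uniform time ≤ s + 1, any space}` (this file), the non-uniform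
upper bound sits at space `2 s log s + 11 s + 6` (THEOREM H′), and the open, magnifying content of
the hypothesis is uniform poly(s) time at levels `c ≥ 2` — the corridor-B twin of THEOREMS F♯/F♭
for SAT's own family. References: [McKayMurrayWilliams2019, Thm. 1.3]; the argument is
[folklore].
-/

namespace Summit.PneNP.PneNP.Theorems.SoloBlind

open Computability
open Literature.Computability.Complexity Literature.Computability.MetaComplexity
open Literature.Computability.MetaComplexity.McKayMurrayWilliams2019

/-- **THEOREM H♭ (level `c = 1` of the family in update TIME, any space).** If `s n ≥ n` and
`s n ≤ 2^(n-10)/n` for infinitely many `n`, then for EVERY space bound `S`,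
`MCSP[s] ∉ USTREAM S (s(⌊log₂ N⌋) + 1)`: uniform update/report time `T` forces states of length
`≤ D · T N` on runs (`exists_runsInSpace_mul_of_uniformTime`, the halting rule), and THEOREM H
excludes space `o(s log s)`. The corridor-B twin of THEOREM F♭. [folklore] -/
theorem MCSPSize_not_mem_USTREAM_time_level_one {s : ℕ → ℕ} (hs : ∀ n, n ≤ s n)
    (hio : ∀ n₀, ∃ n, n₀ ≤ n ∧ s n ≤ 2 ^ (n - 10) / n) (S : ℕ → ℕ) :
    MCSPSize s ∉ USTREAM S (fun N => s (Nat.log 2 N) + 1) := by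
  rintro ⟨A, -, -, hU, hR, hD⟩
  obtain ⟨D, hSp⟩ := exists_runsInSpace_mul_of_uniformTime hU hR
  obtain ⟨n, hn, hsmall⟩ := hio (2 ^ (2 ^ 18 * (D + 1) + 1))
  have hbig : 2 ^ (2 ^ 18 * (D + 1) + 1) ≤ s n := hn.trans (hs n)
  have h36 : 2 ^ 36 ≤ s n := by
    refine (Nat.pow_le_pow_right (by norm_num) ?_).trans hbig
    have : 2 ^ 18 ≤ 2 ^ 18 * (D + 1) := Nat.le_mul_of_pos_right _ (by omega)
    have h18 : (36 : ℕ) ≤ 2 ^ 18 := by norm_num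
    omega
  have h := MCSPSize_streaming_space hSp hD hs h36 hsmall
  simp only [Nat.log_pow Nat.one_lt_two] at h
  have hlog : 2 ^ 18 * (D + 1) + 1 ≤ Nat.log 2 (s n) := Nat.le_log_of_pow_le (by norm_num) hbig
  have h1 : s n * (2 ^ 18 * (D + 1) + 1) ≤ 2 ^ 17 * (D * (s n + 1) + 1) :=
    (Nat.mul_le_mul_left _ hlog).trans h
  have hs1 : 1 ≤ s n := Nat.one_le_two_pow.trans hbig
  have h2 : D ≤ D * s n := Nat.le_mul_of_pos_right D hs1
  norm_num at h1
  nlinarith [h1, h2, hs1]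

/-- **Level one of `StreamingLowerBound s` literally, for every space bound**:
`MCSP[s] ∉ USTREAM S (fun N => s(⌊log₂N⌋)^1 + 1)` for all `S`, under the hypotheses of
THEOREM H♭. [folklore] -/
theorem MCSPSize_not_mem_USTREAM_pow_one {s : ℕ → ℕ} (hs : ∀ n, n ≤ s n)
    (hio : ∀ n₀, ∃ n, n₀ ≤ n ∧ s n ≤ 2 ^ (n - 10) / n) (S : ℕ → ℕ) :
    MCSPSize s ∉ USTREAM S (fun N => s (Nat.log 2 N) ^ 1 + 1) := by
  simpa only [pow_one] using MCSPSize_not_mem_USTREAM_time_level_one hs hio S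

end Summit.PneNP.PneNP.Theorems.SoloBlind
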